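import Summits.Ventures.YMGap.Thresholds.PressureDerivativeSUN
import Summits.Ventures.YMGap.Thresholds.CouplingSecondDerivativeDim
import HarnessLib

/-!
# The free energy density of `SU(N)` lattice Yang–Mills on `ℤ^d` is `C³` on the strong-coupling window — every `N ≥ 2`,
# EVERY `d ≥ 2`, at 't Hooft `0 < (d−1) b/N < 1/12` (row type C-PRESS3, every `N`, every `d`)

Cell `pub-ymgap`, seat ds-1 (gen 10). HONEST FRAMING: strong-coupling LATTICE statements for `SU(N)` Wilson lattice gauge theory on
`ℤ^d`, HYPOTHESIS-FREE (Bakry–Émery one-link modulus `oneLinkKRModulus_SU`); `C³` regularity of the infinite-volume free energy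
density `f(b) = freeEnergyDensity d ρ_N b` in the tree coupling `b` — NOT analyticity; the window `(0, N/(12(d−1)))` is where the
one-sided vertex-star Dobrushin bound closes, not a transition; nothing about the continuum or the Clay problem. 0 compute.

g9's part 3 (`PressureDerivativeSUN`) proved `f''(b) = Σ_{i<j} N² Σ_q Cov_{μ_b}(W_{p_ij}, W_q)` (`W = (1/N) Re tr`); this seat's
every-`N` C-DIFF2 (`hasDerivAt_responseSum_star_dim`) differentiates the plaquette susceptibility once more:

* `hasDerivAt_susceptibilitySum_dim_thooft` — `d/db Σ_{i<j} N² Σ_q Cov_b(W_{p_ij}, W_q) = Σ_{i<j} N² Σ_q N Σ_r u₃(W_{p_ij}; W_q; W_r)`;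
* ★★ `hasDerivAt_deriv_deriv_freeEnergyDensity_dim_thooft` — `f''` is differentiable at every `0 < b < N/(12(d−1))` with
  `f'''(b) = Σ_{i<j} N² Σ_q N Σ_r u₃(W_{p_ij}; W_q; W_r)_{μ_b}`; `deriv_deriv_deriv_freeEnergyDensity_eq_dim_thooft` — for EVERY
  `ν ∈ 𝒢(b)`;
* `continuousOn_thirdResponse_dim_thooft` — `f'''` is continuous on `[0, N/(12(d−1))]`;
* ★★ `contDiffOn_three_freeEnergyDensity_dim_thooft : ContDiffOn ℝ 3 (freeEnergyDensity d (fundamentalRep (Fin N))) (Ioo 0 (N/(12(d−1))))`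
  — every `N ≥ 2`: no first-, second- or third-order transition in the strong-coupling window, as a kernel theorem.

References (mechanism): B. Simon, *The Statistical Mechanics of Lattice Gases* I (1993) §II.12; H. Shen, R. Zhu, X. Zhu,
CMP 400 (2023) Lemma 4.1. All inputs are tree theorems.
-/

noncomputable section

open MeasureTheory ProbabilityTheory Set Filter Topology
open scoped NNReal
open Literature.MathematicalPhysics.QuantumLattice (LGConfig ZdEdge ZdPlaquette fundamentalRep ymGibbsMeasures
  plaquetteEdges freeEnergyDensity)
open Literature.MathematicalPhysics.QuantumFieldTheory hiding ZdEdge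
open Literature.MathematicalPhysics.QuantumFieldTheory.Balaban1983to89.StrongCouplingKernelWindow (oneLinkKRModulus_SU)
open Summit.Ventures.YMGap.StarResolventDim (gaugeR doorPoly)

namespace Summit.Ventures.YMGap.PressureRegularity

section SUNC3

open Summit.Ventures.YMGap.CouplingResponse (hasDerivAt_responseSum_star_dim continuousOn_threePointSum_dim
  exists_dlrSelection_dim bakryEmery_door_dim)

variable {d N : ℕ}

/-- Local shorthand: the any-`d` Dobrushin–Shlosman rate `κ_d(R_G^{(d)}(c)) = (1 − ρ)²/(2(2ρ·2d + 1))`, `ρ = R_G^{(d)}(c)`. -/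
local notation3 (prettyPrint := false) "dimκ(" d' ", " c ")" =>
  (1 - gaugeR d' c) ^ 2 / (2 * (2 * gaugeR d' c * ((2 * d' : ℕ) : ℝ) + 1))

/-- Local shorthand: the planes `{(i, j) : i < j}` of `ℤ^d`. -/
local notation3 (prettyPrint := false) "𝔓₄" => {q : Fin d × Fin d // q.1 < q.2}

/-- Local shorthand: the normalised plaquette observable `W_q = (1/N) Re tr U_q` of `SU(N)` on `ℤ^d`. -/
local notation3 (prettyPrint := false) "W∗" q:max =>
  zdPlaquetteObs (d := d) (fundamentalRep (Fin N)) (Prod.fst q) (Prod.snd q).1.1 (Prod.snd q).1.2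

/-- ★ **The `SU(N)` plaquette susceptibility is differentiable in the coupling**, every `N ≥ 2`, hypothesis-free: along any
DLR selection on `[0, N/(12(d−1))]`, for every plaquette `p` and `0 < b < N/(12(d−1))`,
`d/db Σ_q Cov_{μ_b}(W_p, W_q) = Σ_q N Σ_r u₃(W_p; W_q; W_r)_{μ_b}` (this seat's every-`N` C-DIFF2 with the Bakry–Émery
modulus). -/
theorem hasDerivAt_susceptibility_dim_thooft (hd : 2 ≤ d) (hN : 2 ≤ N)
    {μ : ℝ → Measure (LGConfig d (Matrix.specialUnitaryGroup (Fin N) ℂ))}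
    (hμ : ∀ b ∈ Icc (0 : ℝ) ((N : ℝ) / (12 * ((d : ℝ) - 1))), μ b ∈ ymGibbsMeasures (d := d) (fundamentalRep (Fin N)) b)
    (p : ZdPlaquette d) {b : ℝ} (hb : b ∈ Ioo (0 : ℝ) ((N : ℝ) / (12 * ((d : ℝ) - 1)))) :
    HasDerivAt (fun t => ∑' q : ZdPlaquette d, cov[W∗ p, W∗ q; μ t])
      (∑' q : ZdPlaquette d, (N : ℝ) * ∑' r : ZdPlaquette d, (cov[fun U => (W∗ p) U * (W∗ q) U, W∗ r; μ b] -
        (∫ U, (W∗ p) U ∂(μ b)) * cov[W∗ q, W∗ r; μ b] - (∫ U, (W∗ q) U ∂(μ b)) * cov[W∗ p, W∗ r; μ b])) b := by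
  obtain ⟨h1, hK0, hdoor⟩ := bakryEmery_door_dim (N := N) hd (by omega)
  exact hasDerivAt_responseSum_star_dim hd (by omega) hK0 (oneLinkKRModulus_SU hN h1) le_rfl hdoor hμ
    (isLipschitzCylinder_zdPlaquetteObs (N := N) p.1 p.2.2) (x₀ := p.1) (D := 1)
    (fun e he => by simpa using norm_fst_sub_le_of_mem_plaquetteEdges he) hb

/-- ★ **`Σ_{i<j} N² Σ_q Cov(W_{p_ij}, W_q)` is differentiable in the coupling**, derivative
`Σ_{i<j} N² · Σ_q N Σ_r u₃(W_{p_ij}; W_q; W_r)`, every `N ≥ 2`, `0 < b < N/(12(d−1))`. -/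
theorem hasDerivAt_susceptibilitySum_dim_thooft (hd : 2 ≤ d) (hN : 2 ≤ N)
    {μ : ℝ → Measure (LGConfig d (Matrix.specialUnitaryGroup (Fin N) ℂ))}
    (hμ : ∀ b ∈ Icc (0 : ℝ) ((N : ℝ) / (12 * ((d : ℝ) - 1))), μ b ∈ ymGibbsMeasures (d := d) (fundamentalRep (Fin N)) b)
    {b : ℝ} (hb : b ∈ Ioo (0 : ℝ) ((N : ℝ) / (12 * ((d : ℝ) - 1)))) :
    HasDerivAt (fun t => ∑ q : 𝔓₄, (N : ℝ) ^ 2 * ∑' r : ZdPlaquette d, cov[zdPlaquetteObs (fundamentalRep (Fin N)) 0 q.1.1 q.1.2,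
        zdPlaquetteObs (fundamentalRep (Fin N)) r.1 r.2.1.1 r.2.1.2; μ t])
      (∑ q : 𝔓₄, (N : ℝ) ^ 2 * ∑' s : ZdPlaquette d, (N : ℝ) * ∑' r : ZdPlaquette d,
        (cov[fun U => (W∗ ((0 : Literature.Probability.LatticeModels.Site d), q)) U * (W∗ s) U, W∗ r; μ b] -
          (∫ U, (W∗ ((0 : Literature.Probability.LatticeModels.Site d), q)) U ∂(μ b)) * cov[W∗ s, W∗ r; μ b] -
          (∫ U, (W∗ s) U ∂(μ b)) * cov[W∗ ((0 : Literature.Probability.LatticeModels.Site d), q), W∗ r; μ b])) b :=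
  HasDerivAt.fun_sum (u := (Finset.univ : Finset 𝔓₄)) fun q _ =>
    (hasDerivAt_susceptibility_dim_thooft hd hN hμ ((0 : Literature.Probability.LatticeModels.Site d), q) hb).const_mul
      ((N : ℝ) ^ 2)

/-- ★★ **EVERY `SU(N)`, `N ≥ 2`, EVERY `d ≥ 2`: the free energy density is THREE TIMES differentiable at every `0 < b < N/(12(d−1))`, with
`f'''(b) = Σ_{i<j} N² Σ_q N Σ_r u₃(W_{p_ij}; W_q; W_r)_{μ_b}`** (`W = (1/N) Re tr`), hypothesis-free. -/
theorem hasDerivAt_deriv_deriv_freeEnergyDensity_dim_thooft (hd : 2 ≤ d) (hN : 2 ≤ N)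
    {μ : ℝ → Measure (LGConfig d (Matrix.specialUnitaryGroup (Fin N) ℂ))}
    (hμ : ∀ b ∈ Icc (0 : ℝ) ((N : ℝ) / (12 * ((d : ℝ) - 1))), μ b ∈ ymGibbsMeasures (d := d) (fundamentalRep (Fin N)) b)
    {b : ℝ} (hb : b ∈ Ioo (0 : ℝ) ((N : ℝ) / (12 * ((d : ℝ) - 1)))) :
    HasDerivAt (deriv (deriv (freeEnergyDensity d (fundamentalRep (Fin N)))))
      (∑ q : 𝔓₄, (N : ℝ) ^ 2 * ∑' s : ZdPlaquette d, (N : ℝ) * ∑' r : ZdPlaquette d,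
        (cov[fun U => (W∗ ((0 : Literature.Probability.LatticeModels.Site d), q)) U * (W∗ s) U, W∗ r; μ b] -
          (∫ U, (W∗ ((0 : Literature.Probability.LatticeModels.Site d), q)) U ∂(μ b)) * cov[W∗ s, W∗ r; μ b] -
          (∫ U, (W∗ s) U ∂(μ b)) * cov[W∗ ((0 : Literature.Probability.LatticeModels.Site d), q), W∗ r; μ b])) b := by
  refine (hasDerivAt_susceptibilitySum_dim_thooft hd hN hμ hb).congr_of_eventuallyEq ?_
  filter_upwards [Ioo_mem_nhds hb.1 hb.2] with t ht
  exact (hasDerivAt_freeEnergyDensity_dim_thooft_of_mem hd hN ht (hμ t ⟨ht.1.le, ht.2.le⟩)).2.deriv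

/-- **The third thermodynamic identity at EVERY coupling of the open window, every `SU(N)`**: `f'''(b) = Σ_{i<j} N² Σ_q N Σ_r u₃(…)_ν`
for every DLR state `ν ∈ 𝒢(b)`, `0 < b < N/(12(d−1))`. -/
theorem deriv_deriv_deriv_freeEnergyDensity_eq_dim_thooft (hd : 2 ≤ d) (hN : 2 ≤ N) {b : ℝ} (hb : b ∈ Ioo (0 : ℝ) ((N : ℝ) / (12 * ((d : ℝ) - 1))))
    {ν : Measure (LGConfig d (Matrix.specialUnitaryGroup (Fin N) ℂ))}
    (hν : ν ∈ ymGibbsMeasures (d := d) (fundamentalRep (Fin N)) b) :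
    deriv (deriv (deriv (freeEnergyDensity d (fundamentalRep (Fin N))))) b =
      ∑ q : 𝔓₄, (N : ℝ) ^ 2 * ∑' s : ZdPlaquette d, (N : ℝ) * ∑' r : ZdPlaquette d,
        (cov[fun U => (W∗ ((0 : Literature.Probability.LatticeModels.Site d), q)) U * (W∗ s) U, W∗ r; ν] -
          (∫ U, (W∗ ((0 : Literature.Probability.LatticeModels.Site d), q)) U ∂ν) * cov[W∗ s, W∗ r; ν] -
          (∫ U, (W∗ s) U ∂ν) * cov[W∗ ((0 : Literature.Probability.LatticeModels.Site d), q), W∗ r; ν]) := by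
  classical
  obtain ⟨μ, hμ⟩ := exists_dlrSelection_dim (N := N)
  have hsel : ∀ t ∈ Icc (0 : ℝ) ((N : ℝ) / (12 * ((d : ℝ) - 1))),
      (fun t => if t = b then ν else μ t) t ∈ ymGibbsMeasures (d := d) (fundamentalRep (Fin N)) t := by
    intro t _
    by_cases ht : t = b
    · simp only [ht, if_true]; exact hν
    · simp only [ht, if_false]; exact hμ t
  have h := (hasDerivAt_deriv_deriv_freeEnergyDensity_dim_thooft hd hN hsel hb).deriv
  simpa using h

/-- **`f'''` is continuous on the closed window `[0, N/(12(d−1))]`**, every `N ≥ 2` (this seat's `continuousOn_threePointSum_dim`). -/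
theorem continuousOn_thirdResponse_dim_thooft (hd : 2 ≤ d) (hN : 2 ≤ N)
    {μ : ℝ → Measure (LGConfig d (Matrix.specialUnitaryGroup (Fin N) ℂ))}
    (hμ : ∀ b ∈ Icc (0 : ℝ) ((N : ℝ) / (12 * ((d : ℝ) - 1))), μ b ∈ ymGibbsMeasures (d := d) (fundamentalRep (Fin N)) b) :
    ContinuousOn (fun b => ∑ q : 𝔓₄, (N : ℝ) ^ 2 * ∑' s : ZdPlaquette d, (N : ℝ) * ∑' r : ZdPlaquette d,
        (cov[fun U => (W∗ ((0 : Literature.Probability.LatticeModels.Site d), q)) U * (W∗ s) U, W∗ r; μ b] -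
          (∫ U, (W∗ ((0 : Literature.Probability.LatticeModels.Site d), q)) U ∂(μ b)) * cov[W∗ s, W∗ r; μ b] -
          (∫ U, (W∗ s) U ∂(μ b)) * cov[W∗ ((0 : Literature.Probability.LatticeModels.Site d), q), W∗ r; μ b]))
      (Icc (0 : ℝ) ((N : ℝ) / (12 * ((d : ℝ) - 1)))) := by
  obtain ⟨h1, hK0, hdoor⟩ := bakryEmery_door_dim (N := N) hd (by omega)
  refine continuousOn_finsetSum _ fun q _ => continuousOn_const.mul ?_
  exact continuousOn_threePointSum_dim hd (by omega) hK0 (oneLinkKRModulus_SU hN h1) le_rfl hdoor hμ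
    (isLipschitzCylinder_zdPlaquetteObs (N := N) (0 : Literature.Probability.LatticeModels.Site d) q.2)
    (x₀ := 0) (D := 1) (fun e he => by simpa using norm_fst_sub_le_of_mem_plaquetteEdges he)

/-- ★★ **EVERY `SU(N)`, `N ≥ 2`: `f ∈ C³` on the open window `(0, N/(12(d−1)))`** — `ContDiffOn ℝ 3 (freeEnergyDensity d ρ_{SU(N)})
(Ioo 0 (N/(12(d−1))))`: no transition of order `≤ 3` in the strong-coupling window, as a kernel theorem, hypothesis-free. -/
theorem contDiffOn_three_freeEnergyDensity_dim_thooft (hd : 2 ≤ d) (hN : 2 ≤ N) :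
    ContDiffOn ℝ 3 (freeEnergyDensity d (fundamentalRep (Fin N))) (Ioo (0 : ℝ) ((N : ℝ) / (12 * ((d : ℝ) - 1)))) := by
  obtain ⟨μ, hμ⟩ := exists_dlrSelection_dim (N := N)
  have hsel : ∀ t ∈ Icc (0 : ℝ) ((N : ℝ) / (12 * ((d : ℝ) - 1))), μ t ∈ ymGibbsMeasures (d := d) (fundamentalRep (Fin N)) t :=
    fun t _ => hμ t
  have h2 := contDiffOn_two_freeEnergyDensity_dim_thooft hd hN
  rw [show (2 : WithTop ℕ∞) = 1 + 1 from rfl, contDiffOn_succ_iff_deriv_of_isOpen isOpen_Ioo] at h2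
  obtain ⟨hd1, -, h1⟩ := h2
  rw [show (1 : WithTop ℕ∞) = 0 + 1 from (zero_add 1).symm, contDiffOn_succ_iff_deriv_of_isOpen isOpen_Ioo] at h1
  obtain ⟨hd2, -, -⟩ := h1
  rw [show (3 : WithTop ℕ∞) = 2 + 1 from rfl, contDiffOn_succ_iff_deriv_of_isOpen isOpen_Ioo]
  refine ⟨hd1, fun h => absurd h (by simp), ?_⟩
  rw [show (2 : WithTop ℕ∞) = 1 + 1 from rfl, contDiffOn_succ_iff_deriv_of_isOpen isOpen_Ioo]
  refine ⟨hd2, fun h => absurd h (by simp), ?_⟩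
  exact CouplingResponse.contDiffOn_one_of_hasDerivAt
    (fun t ht => hasDerivAt_deriv_deriv_freeEnergyDensity_dim_thooft hd hN hsel ht) (continuousOn_thirdResponse_dim_thooft hd hN hsel)

/-- **`SU(2)` on `ℤ³`**: the free energy density is `C³` on `(0, 1/12)` (tree coupling; `N/(12(d−1)) = 2/24`). -/
theorem su2_dim3_contDiffOn_three_freeEnergyDensity :
    ContDiffOn ℝ 3 (freeEnergyDensity 3 (fundamentalRep (Fin 2))) (Ioo (0 : ℝ) (1 / 12)) := by
  have h := contDiffOn_three_freeEnergyDensity_dim_thooft (d := 3) (N := 2) (by norm_num) (by norm_num)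
  norm_num at h
  exact h

/-- **`SU(3)` on `ℤ³`**: the free energy density is `C³` on `(0, 1/8)` (tree coupling; `N/(12(d−1)) = 3/24`). -/
theorem su3_dim3_contDiffOn_three_freeEnergyDensity :
    ContDiffOn ℝ 3 (freeEnergyDensity 3 (fundamentalRep (Fin 3))) (Ioo (0 : ℝ) (1 / 8)) := by
  have h := contDiffOn_three_freeEnergyDensity_dim_thooft (d := 3) (N := 3) (by norm_num) (by norm_num)
  norm_num at h
  exact h

end SUNC3

end Summit.Ventures.YMGap.PressureRegularity

end
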